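import Summits.CriticalPhenomena.PercolationContinuityZ3.Theorems.PercNearOneGluingNoHeavyLowerTailQuantitativeOneSideSizeLemma
import Summits.CriticalPhenomena.PercolationContinuityZ3.Theorems.PercNearOneGluingNoHeavyLowerTailQuantitativeSeparatorIdentities
import HarnessLib

/-!
# The SIZE LAW for the first-order constant on the whole SEPARATOR CLASS (BENCH rows M2-R53 (S1) / M2-R57 (C1), PROOFS §P56 (C1)):
# `c ≤ |L||R|/(|L| + |R| + E T) − 1`

Support file (`--supports stmt-CriticalPhenomena-4575`), prover seat `prim-rate-mine-2` (lane prim-rate, constants-miner (c);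
`run/shared/lean/prim/prim-rate/prim-rate-mine-2/PROOFS.md` §P54 (c), §P56 (C1); BENCH rows l.191 M2-R53, l.192 M2-R54, l.197 M2-R57).
No definitions, no named facts, no sorries; standard axioms.

SETTING (the separator class, as in `…QuantitativeSeparatorIdentities`): pair weights `w` on a finite vertex type, `x ≠ a`,
`L ∌ x, a` with `b ∈ L`, `u ∉ L`, and weight `0` on every pair that is on neither side of `{x,a}`.  `T = {x↔a}`, `F = {x↔b}`,
`G = {x↔u}`, `Cov = μ(F∩G) − μ(F)μ(G)`, `M = μ(T∩F∩G) + μ(T)μ(F∩G) − μ(F)μ(T∩G) − μ(G)μ(T∩F)`, `c = −M/Cov`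
(`covD/Cov_{w_Y} = 1 + c·t + O(t²)`, `CSH.covD_onePair_eq`).  `|L|` = the number of vertices of `L`, `|R|` = the number of
vertices off `L ∪ {x,a}` (so `|L| + |R| = |V| − 2`).

* side bridges: the ONE-SIDE SIZE LEMMA (`CSH.oneSideCov_le_count_mul`) applied to the side weight functions
  (`w` restricted to the `L`-side pairs, resp. the `R`-side pairs) reads `φ_L ≤ |L|·λ_L`, `φ_R ≤ |R|·λ_R` in the side statistics
  of the identities file (`CSH.sep_phiL_le`, `CSH.sep_phiR_le`); Harris gives `φ_L, φ_R ≥ 0`;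
* **`CSH.sep_sizeLaw`** — `(Cov − M)·(|L| + |R| + μ(T)) ≤ |L|·|R|·Cov`, i.e. (for `Cov > 0`)
  **`1 + c ≤ |L||R|/(|L| + |R| + E T)`**, hence `c ≤ ⌊(n−2)²/4⌋/(n−2) − 1` with `n = |V|`: the SIZE LAW (S1) of BENCH l.191 with
  the floor, for EVERY weighted graph in which `{x,a}` separates `b` from `u`, every `n` (sharp along the hub–path towers `H⁻_{n−2}`,
  BENCH l.187).  Proof: (I2) `Cov − M = φ_Lφ_R`, (I1) `Cov = λ_Rφ_L + λ_Lφ_R + λ_Lλ_R μ(T)`, and the two one-side bounds.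
[cite: VandenbergHaggstromKahn2005, Thm. 1.3 (p. 6)] [cite: Harris1960, Lemma 4.1 (p. 16)]
-/

noncomputable section

namespace Summit.CriticalPhenomena.PercolationContinuityZ3.Theorems.CSH

open MeasureTheory Set unitInterval
open Literature.Probability.LatticeModels (prodBernoulli prodBernoulli_harris)
open Literature.Probability.Percolation
open Literature.Probability.Percolation.KNSep
open scoped Classical

variable {V : Type*} [Fintype V]

section SizeLaw

variable (w : Sym2 V → unitInterval) (L : Set V) (x a b u : V)


/-! ### Bridges between a side weight function and the side statistics -/

/-- Under a weight function vanishing off a set of pairs `E`, almost surely every open pair lies in `E`, so connection events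
may be read off `ω ∩ E`. [folklore] -/
theorem sep_real_restrict_eq (E : Set (Sym2 V)) (P : Set (Sym2 V) → Prop) :
    (prodBernoulli fun e : Sym2 V => if e ∈ E then w e else 0).real {ω | P ω} =
      (prodBernoulli w).real {ω | P (ω ∩ E)} := by
  have h1 : (prodBernoulli fun e : Sym2 V => if e ∈ E then w e else 0).real {ω | P ω} =
      (prodBernoulli fun e : Sym2 V => if e ∈ E then w e else 0).real {ω | P (ω ∩ E)} := by
    refine real_eq_of_inter_sureSet _ (Set.ext fun ω => ?_)
    simp only [Set.mem_inter_iff, Set.mem_setOf_eq]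
    constructor
    · rintro ⟨h, hω⟩
      have : ω ∩ E = ω := Set.inter_eq_left.2 fun e he => by
        by_contra heE
        exact (hω e).1 (by simp only [heE, if_false]) he
      exact ⟨by rwa [this], hω⟩
    · rintro ⟨h, hω⟩
      have : ω ∩ E = ω := Set.inter_eq_left.2 fun e he => by
        by_contra heE
        exact (hω e).1 (by simp only [heE, if_false]) he
      exact ⟨by rwa [this] at h, hω⟩
  rw [h1]
  exact real_eq_of_agree _ w E (fun e he => by simp only [he, if_true]) (determinedBy_setOf_inter E P)

/-- **`L`-side bridge.**  The ONE-SIDE SIZE LEMMA for `w` restricted to the `L`-side pairs, in the side statistics: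
`φ_L ≤ |L| · λ_L`. [cite: VandenbergHaggstromKahn2005, Thm. 1.3 (p. 6)] -/
theorem sep_phiL_le :
    (prodBernoulli w).real ((({ω : BondConfig V | rB L {x, a} ω x a} : Set (BondConfig V))) ∩ ((({ω : BondConfig V | rB L {x, a} ω x b} : Set (BondConfig V))) ∪ (({ω : BondConfig
          V | rB L {x, a} ω a b} : Set (BondConfig V))))) - (prodBernoulli w).real (({ω : BondConfig V | rB L {x, a} ω x a} : Set (BondConfig V))) * (prodBernoulli w).real ((({ω :
          BondConfig V | rB L {x, a} ω x b} : Set (BondConfig V))) ∪ (({ω : BondConfig V | rB L {x, a} ω a b} : Set (BondConfig V)))) ≤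
      (L.toFinset.card : ℝ) * (prodBernoulli w).real ((({ω : BondConfig V | rB L {x, a} ω a b} : Set (BondConfig V)) ∩ ({ω : BondConfig V | rB L {x, a} ω x b} : Set (BondConfig
            V))ᶜ)) := by
  have h : (prodBernoulli ((fun e : Sym2 V => if e ∈ sideB L ({x, a} : Set V) then w e else 0))).real {ω | (openGraph ω).Reachable x a ∧
        ((openGraph ω).Reachable b x ∨ (openGraph ω).Reachable b a)} -
      (prodBernoulli ((fun e : Sym2 V => if e ∈ sideB L ({x, a} : Set V) then w e else 0))).real {ω | (openGraph ω).Reachable x a} *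
        (prodBernoulli ((fun e : Sym2 V => if e ∈ sideB L ({x, a} : Set V) then w e else 0))).real {ω | (openGraph ω).Reachable b x ∨ (openGraph ω).Reachable b a} ≤
      ((Finset.univ.filter fun v : V => v ≠ x ∧ 0 < (prodBernoulli ((fun e : Sym2 V => if e ∈ sideB L ({x, a} : Set V) then w e else 0))).real (openConn a v) ∧
        (prodBernoulli ((fun e : Sym2 V => if e ∈ sideB L ({x, a} : Set V) then w e else 0))).real (openConn a v) < 1).card : ℝ) *
      (prodBernoulli ((fun e : Sym2 V => if e ∈ sideB L ({x, a} : Set V) then w e else 0))).real {ω | (openGraph ω).Reachable b a ∧ ¬ (openGraph ω).Reachable b x} :=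
    oneSideCov_le_count_mul ((fun e : Sym2 V => if e ∈ sideB L ({x, a} : Set V) then w e else 0)) x a b
  have e1 : (prodBernoulli ((fun e : Sym2 V => if e ∈ sideB L ({x, a} : Set V) then w e else 0))).real {ω | (openGraph ω).Reachable x a ∧
        ((openGraph ω).Reachable b x ∨ (openGraph ω).Reachable b a)} =
      (prodBernoulli w).real {ω | (openGraph (ω ∩ sideB L ({x, a} : Set V))).Reachable x a ∧
        ((openGraph (ω ∩ sideB L ({x, a} : Set V))).Reachable b x ∨
          (openGraph (ω ∩ sideB L ({x, a} : Set V))).Reachable b a)} :=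
    sep_real_restrict_eq w _ (fun η => (openGraph η).Reachable x a ∧ ((openGraph η).Reachable b x ∨ (openGraph η).Reachable b a))
  have e2 : (prodBernoulli ((fun e : Sym2 V => if e ∈ sideB L ({x, a} : Set V) then w e else 0))).real {ω | (openGraph ω).Reachable x a} =
      (prodBernoulli w).real {ω | (openGraph (ω ∩ sideB L ({x, a} : Set V))).Reachable x a} :=
    sep_real_restrict_eq w _ (fun η => (openGraph η).Reachable x a)
  have e3 : (prodBernoulli ((fun e : Sym2 V => if e ∈ sideB L ({x, a} : Set V) then w e else 0))).real {ω | (openGraph ω).Reachable b x ∨ (openGraph ω).Reachable b a} =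
      (prodBernoulli w).real {ω | (openGraph (ω ∩ sideB L ({x, a} : Set V))).Reachable b x ∨
        (openGraph (ω ∩ sideB L ({x, a} : Set V))).Reachable b a} :=
    sep_real_restrict_eq w _ (fun η => (openGraph η).Reachable b x ∨ (openGraph η).Reachable b a)
  have e4 : (prodBernoulli ((fun e : Sym2 V => if e ∈ sideB L ({x, a} : Set V) then w e else 0))).real {ω | (openGraph ω).Reachable b a ∧ ¬ (openGraph ω).Reachable b x} =
      (prodBernoulli w).real {ω | (openGraph (ω ∩ sideB L ({x, a} : Set V))).Reachable b a ∧
        ¬ (openGraph (ω ∩ sideB L ({x, a} : Set V))).Reachable b x} :=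
    sep_real_restrict_eq w _ (fun η => (openGraph η).Reachable b a ∧ ¬ (openGraph η).Reachable b x)
  have s1 : {ω : BondConfig V | (openGraph (ω ∩ sideB L ({x, a} : Set V))).Reachable x a ∧
        ((openGraph (ω ∩ sideB L ({x, a} : Set V))).Reachable b x ∨
          (openGraph (ω ∩ sideB L ({x, a} : Set V))).Reachable b a)} = ((({ω : BondConfig V | rB L {x, a} ω x a} : Set (BondConfig V))) ∩ ((({ω : BondConfig V | rB L {x, a} ω x b}
                : Set (BondConfig V))) ∪ (({ω : BondConfig V | rB L {x, a} ω a b} : Set (BondConfig V))))) := by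
    ext ω; simp only [Set.mem_setOf_eq, Set.mem_inter_iff, Set.mem_union, rB]
    exact ⟨fun ⟨h1, h2⟩ => ⟨h1, h2.imp SimpleGraph.Reachable.symm SimpleGraph.Reachable.symm⟩,
      fun ⟨h1, h2⟩ => ⟨h1, h2.imp SimpleGraph.Reachable.symm SimpleGraph.Reachable.symm⟩⟩
  have s3 : {ω : BondConfig V | (openGraph (ω ∩ sideB L ({x, a} : Set V))).Reachable b x ∨
        (openGraph (ω ∩ sideB L ({x, a} : Set V))).Reachable b a} = ((({ω : BondConfig V | rB L {x, a} ω x b} : Set (BondConfig V))) ∪ (({ω : BondConfig V | rB L {x, a} ω a b} :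
              Set (BondConfig V)))) := by
    ext ω; simp only [Set.mem_setOf_eq, Set.mem_union, rB]
    exact ⟨fun h => h.imp SimpleGraph.Reachable.symm SimpleGraph.Reachable.symm,
      fun h => h.imp SimpleGraph.Reachable.symm SimpleGraph.Reachable.symm⟩
  have s4 : {ω : BondConfig V | (openGraph (ω ∩ sideB L ({x, a} : Set V))).Reachable b a ∧
        ¬ (openGraph (ω ∩ sideB L ({x, a} : Set V))).Reachable b x} = ((({ω : BondConfig V | rB L {x, a} ω a b} : Set (BondConfig V)) ∩ ({ω : BondConfig V | rB L {x, a} ω x b} :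
              Set (BondConfig V))ᶜ)) := by
    ext ω; simp only [Set.mem_setOf_eq, Set.mem_inter_iff, Set.mem_compl_iff, rB]
    exact ⟨fun ⟨h1, h2⟩ => ⟨h1.symm, fun h => h2 h.symm⟩, fun ⟨h1, h2⟩ => ⟨h1.symm, fun h => h2 h.symm⟩⟩
  -- the count: only vertices of `L` are counted
  have hk : ((Finset.univ.filter fun v : V => v ≠ x ∧ 0 < (prodBernoulli ((fun e : Sym2 V => if e ∈ sideB L ({x, a} : Set V) then w e else 0))).real (openConn a v) ∧
      (prodBernoulli ((fun e : Sym2 V => if e ∈ sideB L ({x, a} : Set V) then w e else 0))).real (openConn a v) < 1).card : ℝ) ≤ (L.toFinset.card : ℝ) := by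
    have hsub : (Finset.univ.filter fun v : V => v ≠ x ∧ 0 < (prodBernoulli ((fun e : Sym2 V => if e ∈ sideB L ({x, a} : Set V) then w e else 0))).real (openConn a v) ∧
        (prodBernoulli ((fun e : Sym2 V => if e ∈ sideB L ({x, a} : Set V) then w e else 0))).real (openConn a v) < 1) ⊆ L.toFinset := by
      intro v hv
      rw [Finset.mem_filter] at hv
      rw [Set.mem_toFinset]
      by_contra hvL
      by_cases hva : v = a
      · rw [hva] at hv
        have : (prodBernoulli ((fun e : Sym2 V => if e ∈ sideB L ({x, a} : Set V) then w e else 0))).real (openConn a a : Set (BondConfig V)) = 1 := by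
          rw [show (openConn a a : Set (BondConfig V)) = Set.univ from
            Set.eq_univ_of_forall fun _ => SimpleGraph.Reachable.refl _]
          exact probReal_univ
        exact absurd this (ne_of_lt hv.2.2.2)
      · -- `v ∉ L ∪ {x,a}` cannot be reached from `a` through `L`-side pairs
        have h0 : (prodBernoulli ((fun e : Sym2 V => if e ∈ sideB L ({x, a} : Set V) then w e else 0))).real (openConn a v : Set (BondConfig V)) = 0 := by
          have hr : (prodBernoulli ((fun e : Sym2 V => if e ∈ sideB L ({x, a} : Set V) then w e else 0))).real {ω | (openGraph ω).Reachable a v} =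
              (prodBernoulli w).real {ω | (openGraph (ω ∩ sideB L ({x, a} : Set V))).Reachable a v} :=
            sep_real_restrict_eq w _ (fun η => (openGraph η).Reachable a v)
          rw [show (openConn a v : Set (BondConfig V)) = {ω | (openGraph ω).Reachable a v} from rfl, hr]
          refine le_antisymm ((measureReal_mono fun ω hω => ?_).trans (le_of_eq measureReal_empty)) measureReal_nonneg
          have hmem := @osl_reachable_mem_of_closed V (ω ∩ sideB L ({x, a} : Set V))
            {z' : V | z' ∈ L ∨ z' ∈ ({x, a} : Set V)} a v (Or.inr (Or.inr rfl))
            (fun z _ y' hy' he => hy' (he.2 y' (Sym2.mem_mk_right z y'))) hω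
          rcases hmem with h' | h' | h'
          · exact hvL h'
          · exact hv.2.1 h'
          · exact hva h'
        exact absurd h0 (ne_of_gt hv.2.2.1)
    exact_mod_cast (Finset.card_le_card hsub)
  rw [e1, e2, e3, e4, s1, s3, s4] at h
  exact h.trans (mul_le_mul_of_nonneg_right hk measureReal_nonneg)

/-- **`R`-side bridge.**  The ONE-SIDE SIZE LEMMA for `w` restricted to the `R`-side pairs: `φ_R ≤ |R| · λ_R`,
`|R| = #{v ∉ L, v ≠ x, v ≠ a}`. [cite: VandenbergHaggstromKahn2005, Thm. 1.3 (p. 6)] -/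
theorem sep_phiR_le (ha : a ∉ L) :
    (prodBernoulli w).real ((({ω : BondConfig V | (openGraph (ω ∩ sideT L {x, a})).Reachable x a} : Set (BondConfig V))) ∩ ((({ω : BondConfig V | (openGraph (ω ∩ sideT L {x,
          a})).Reachable x u} : Set (BondConfig V))) ∪ (({ω : BondConfig V | (openGraph (ω ∩ sideT L {x, a})).Reachable a u} : Set (BondConfig V))))) - (prodBernoulli w).real (({ω
          : BondConfig V | (openGraph (ω ∩ sideT L {x, a})).Reachable x a} : Set (BondConfig V))) * (prodBernoulli w).real ((({ω : BondConfig V | (openGraph (ω ∩ sideT L {x,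
          a})).Reachable x u} : Set (BondConfig V))) ∪ (({ω : BondConfig V | (openGraph (ω ∩ sideT L {x, a})).Reachable a u} : Set (BondConfig V)))) ≤
      ((Finset.univ.filter fun v : V => v ∉ L ∧ v ≠ x ∧ v ≠ a).card : ℝ) * (prodBernoulli w).real ((({ω : BondConfig V | (openGraph (ω ∩ sideT L {x, a})).Reachable a u} : Set
            (BondConfig V)) ∩ ({ω : BondConfig V | (openGraph (ω ∩ sideT L {x, a})).Reachable x u} : Set (BondConfig V))ᶜ)) := by
  have h : (prodBernoulli ((fun e : Sym2 V => if e ∈ sideT L ({x, a} : Set V) then w e else 0))).real {ω | (openGraph ω).Reachable x a ∧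
        ((openGraph ω).Reachable u x ∨ (openGraph ω).Reachable u a)} -
      (prodBernoulli ((fun e : Sym2 V => if e ∈ sideT L ({x, a} : Set V) then w e else 0))).real {ω | (openGraph ω).Reachable x a} *
        (prodBernoulli ((fun e : Sym2 V => if e ∈ sideT L ({x, a} : Set V) then w e else 0))).real {ω | (openGraph ω).Reachable u x ∨ (openGraph ω).Reachable u a} ≤
      ((Finset.univ.filter fun v : V => v ≠ x ∧ 0 < (prodBernoulli ((fun e : Sym2 V => if e ∈ sideT L ({x, a} : Set V) then w e else 0))).real (openConn a v) ∧
        (prodBernoulli ((fun e : Sym2 V => if e ∈ sideT L ({x, a} : Set V) then w e else 0))).real (openConn a v) < 1).card : ℝ) *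
      (prodBernoulli ((fun e : Sym2 V => if e ∈ sideT L ({x, a} : Set V) then w e else 0))).real {ω | (openGraph ω).Reachable u a ∧ ¬ (openGraph ω).Reachable u x} :=
    oneSideCov_le_count_mul ((fun e : Sym2 V => if e ∈ sideT L ({x, a} : Set V) then w e else 0)) x a u
  have e1 : (prodBernoulli ((fun e : Sym2 V => if e ∈ sideT L ({x, a} : Set V) then w e else 0))).real {ω | (openGraph ω).Reachable x a ∧
        ((openGraph ω).Reachable u x ∨ (openGraph ω).Reachable u a)} =
      (prodBernoulli w).real {ω | (openGraph (ω ∩ sideT L ({x, a} : Set V))).Reachable x a ∧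
        ((openGraph (ω ∩ sideT L ({x, a} : Set V))).Reachable u x ∨
          (openGraph (ω ∩ sideT L ({x, a} : Set V))).Reachable u a)} :=
    sep_real_restrict_eq w _ (fun η => (openGraph η).Reachable x a ∧ ((openGraph η).Reachable u x ∨ (openGraph η).Reachable u a))
  have e2 : (prodBernoulli ((fun e : Sym2 V => if e ∈ sideT L ({x, a} : Set V) then w e else 0))).real {ω | (openGraph ω).Reachable x a} =
      (prodBernoulli w).real {ω | (openGraph (ω ∩ sideT L ({x, a} : Set V))).Reachable x a} :=
    sep_real_restrict_eq w _ (fun η => (openGraph η).Reachable x a)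
  have e3 : (prodBernoulli ((fun e : Sym2 V => if e ∈ sideT L ({x, a} : Set V) then w e else 0))).real {ω | (openGraph ω).Reachable u x ∨ (openGraph ω).Reachable u a} =
      (prodBernoulli w).real {ω | (openGraph (ω ∩ sideT L ({x, a} : Set V))).Reachable u x ∨
        (openGraph (ω ∩ sideT L ({x, a} : Set V))).Reachable u a} :=
    sep_real_restrict_eq w _ (fun η => (openGraph η).Reachable u x ∨ (openGraph η).Reachable u a)
  have e4 : (prodBernoulli ((fun e : Sym2 V => if e ∈ sideT L ({x, a} : Set V) then w e else 0))).real {ω | (openGraph ω).Reachable u a ∧ ¬ (openGraph ω).Reachable u x} =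
      (prodBernoulli w).real {ω | (openGraph (ω ∩ sideT L ({x, a} : Set V))).Reachable u a ∧
        ¬ (openGraph (ω ∩ sideT L ({x, a} : Set V))).Reachable u x} :=
    sep_real_restrict_eq w _ (fun η => (openGraph η).Reachable u a ∧ ¬ (openGraph η).Reachable u x)
  have s1 : {ω : BondConfig V | (openGraph (ω ∩ sideT L ({x, a} : Set V))).Reachable x a ∧
        ((openGraph (ω ∩ sideT L ({x, a} : Set V))).Reachable u x ∨
          (openGraph (ω ∩ sideT L ({x, a} : Set V))).Reachable u a)} = ((({ω : BondConfig V | (openGraph (ω ∩ sideT L {x, a})).Reachable x a} : Set (BondConfig V))) ∩ ((({ω :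
                BondConfig V | (openGraph (ω ∩ sideT L {x, a})).Reachable x u} : Set (BondConfig V))) ∪ (({ω : BondConfig V | (openGraph (ω ∩ sideT L {x, a})).Reachable a u} : Set
                (BondConfig V))))) := by
    ext ω; simp only [Set.mem_setOf_eq, Set.mem_inter_iff, Set.mem_union]
    exact ⟨fun ⟨h1, h2⟩ => ⟨h1, h2.imp SimpleGraph.Reachable.symm SimpleGraph.Reachable.symm⟩,
      fun ⟨h1, h2⟩ => ⟨h1, h2.imp SimpleGraph.Reachable.symm SimpleGraph.Reachable.symm⟩⟩
  have s3 : {ω : BondConfig V | (openGraph (ω ∩ sideT L ({x, a} : Set V))).Reachable u x ∨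
        (openGraph (ω ∩ sideT L ({x, a} : Set V))).Reachable u a} = ((({ω : BondConfig V | (openGraph (ω ∩ sideT L {x, a})).Reachable x u} : Set (BondConfig V))) ∪ (({ω :
              BondConfig V | (openGraph (ω ∩ sideT L {x, a})).Reachable a u} : Set (BondConfig V)))) := by
    ext ω; simp only [Set.mem_setOf_eq, Set.mem_union]
    exact ⟨fun h => h.imp SimpleGraph.Reachable.symm SimpleGraph.Reachable.symm,
      fun h => h.imp SimpleGraph.Reachable.symm SimpleGraph.Reachable.symm⟩
  have s4 : {ω : BondConfig V | (openGraph (ω ∩ sideT L ({x, a} : Set V))).Reachable u a ∧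
        ¬ (openGraph (ω ∩ sideT L ({x, a} : Set V))).Reachable u x} = ((({ω : BondConfig V | (openGraph (ω ∩ sideT L {x, a})).Reachable a u} : Set (BondConfig V)) ∩ ({ω :
              BondConfig V | (openGraph (ω ∩ sideT L {x, a})).Reachable x u} : Set (BondConfig V))ᶜ)) := by
    ext ω; simp only [Set.mem_setOf_eq, Set.mem_inter_iff, Set.mem_compl_iff]
    exact ⟨fun ⟨h1, h2⟩ => ⟨h1.symm, fun h => h2 h.symm⟩, fun ⟨h1, h2⟩ => ⟨h1.symm, fun h => h2 h.symm⟩⟩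
  have hk : ((Finset.univ.filter fun v : V => v ≠ x ∧ 0 < (prodBernoulli ((fun e : Sym2 V => if e ∈ sideT L ({x, a} : Set V) then w e else 0))).real (openConn a v) ∧
      (prodBernoulli ((fun e : Sym2 V => if e ∈ sideT L ({x, a} : Set V) then w e else 0))).real (openConn a v) < 1).card : ℝ) ≤
      ((Finset.univ.filter fun v : V => v ∉ L ∧ v ≠ x ∧ v ≠ a).card : ℝ) := by
    have hsub : (Finset.univ.filter fun v : V => v ≠ x ∧ 0 < (prodBernoulli ((fun e : Sym2 V => if e ∈ sideT L ({x, a} : Set V) then w e else 0))).real (openConn a v) ∧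
        (prodBernoulli ((fun e : Sym2 V => if e ∈ sideT L ({x, a} : Set V) then w e else 0))).real (openConn a v) < 1) ⊆
        (Finset.univ.filter fun v : V => v ∉ L ∧ v ≠ x ∧ v ≠ a) := by
      intro v hv
      rw [Finset.mem_filter] at hv ⊢
      refine ⟨Finset.mem_univ _, fun hvL => ?_, hv.2.1, fun hva => ?_⟩
      · -- `v ∈ L` cannot be reached from `a ∉ L` through `R`-side pairs
        have h0 : (prodBernoulli ((fun e : Sym2 V => if e ∈ sideT L ({x, a} : Set V) then w e else 0))).real (openConn a v : Set (BondConfig V)) = 0 := by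
          have hr : (prodBernoulli ((fun e : Sym2 V => if e ∈ sideT L ({x, a} : Set V) then w e else 0))).real {ω | (openGraph ω).Reachable a v} =
              (prodBernoulli w).real {ω | (openGraph (ω ∩ sideT L ({x, a} : Set V))).Reachable a v} :=
            sep_real_restrict_eq w _ (fun η => (openGraph η).Reachable a v)
          rw [show (openConn a v : Set (BondConfig V)) = {ω | (openGraph ω).Reachable a v} from rfl, hr]
          refine le_antisymm ((measureReal_mono fun ω hω => ?_).trans (le_of_eq measureReal_empty)) measureReal_nonneg
          have hmem := @osl_reachable_mem_of_closed V (ω ∩ sideT L ({x, a} : Set V)) {z' : V | z' ∉ L} a v ha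
            (fun z _ y' hy' he => hy' (he.2.1 y' (Sym2.mem_mk_right z y'))) hω
          exact hmem hvL
        exact absurd h0 (ne_of_gt hv.2.2.1)
      · rw [hva] at hv
        have : (prodBernoulli ((fun e : Sym2 V => if e ∈ sideT L ({x, a} : Set V) then w e else 0))).real (openConn a a : Set (BondConfig V)) = 1 := by
          rw [show (openConn a a : Set (BondConfig V)) = Set.univ from
            Set.eq_univ_of_forall fun _ => SimpleGraph.Reachable.refl _]
          exact probReal_univ
        exact absurd this (ne_of_lt hv.2.2.2)
    exact_mod_cast (Finset.card_le_card hsub)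
  rw [e1, e2, e3, e4, s1, s3, s4] at h
  exact h.trans (mul_le_mul_of_nonneg_right hk measureReal_nonneg)

/-- `L`-side events are increasing, so Harris gives `φ_L ≥ 0`. [cite: Harris1960, Lemma 4.1 (p. 16)] -/
theorem sep_phiL_nonneg :
    0 ≤ (prodBernoulli w).real ((({ω : BondConfig V | rB L {x, a} ω x a} : Set (BondConfig V))) ∩ ((({ω : BondConfig V | rB L {x, a} ω x b} : Set (BondConfig V))) ∪ (({ω :
          BondConfig V | rB L {x, a} ω a b} : Set (BondConfig V))))) - (prodBernoulli w).real (({ω : BondConfig V | rB L {x, a} ω x a} : Set (BondConfig V))) * (prodBernoulli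
          w).real ((({ω : BondConfig V | rB L {x, a} ω x b} : Set (BondConfig V))) ∪ (({ω : BondConfig V | rB L {x, a} ω a b} : Set (BondConfig V)))) := by
  have hmono : ∀ (p q : V), IsUpperSet ({ω : BondConfig V | rB L {x, a} ω p q} : Set (BondConfig V)) :=
    fun p q ω ω' hle h => SimpleGraph.Reachable.mono (openGraph_mono (Set.inter_subset_inter_left _ hle)) h
  have h := prodBernoulli_harris w (hmono x a) ((hmono x b).union (hmono a b))
    MeasurableSet.of_discrete MeasurableSet.of_discrete
  linarith

/-- `R`-side events are increasing, so Harris gives `φ_R ≥ 0`. [cite: Harris1960, Lemma 4.1 (p. 16)] -/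
theorem sep_phiR_nonneg :
    0 ≤ (prodBernoulli w).real ((({ω : BondConfig V | (openGraph (ω ∩ sideT L {x, a})).Reachable x a} : Set (BondConfig V))) ∩ ((({ω : BondConfig V | (openGraph (ω ∩ sideT L {x,
          a})).Reachable x u} : Set (BondConfig V))) ∪ (({ω : BondConfig V | (openGraph (ω ∩ sideT L {x, a})).Reachable a u} : Set (BondConfig V))))) - (prodBernoulli w).real (({ω
          : BondConfig V | (openGraph (ω ∩ sideT L {x, a})).Reachable x a} : Set (BondConfig V))) * (prodBernoulli w).real ((({ω : BondConfig V | (openGraph (ω ∩ sideT L {x,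
          a})).Reachable x u} : Set (BondConfig V))) ∪ (({ω : BondConfig V | (openGraph (ω ∩ sideT L {x, a})).Reachable a u} : Set (BondConfig V)))) := by
  have hmono : ∀ (p q : V),
      IsUpperSet ({ω : BondConfig V | (openGraph (ω ∩ sideT L {x, a})).Reachable p q} : Set (BondConfig V)) :=
    fun p q ω ω' hle h => SimpleGraph.Reachable.mono (openGraph_mono (Set.inter_subset_inter_left _ hle)) h
  have h := prodBernoulli_harris w (hmono x a) ((hmono x u).union (hmono a u))
    MeasurableSet.of_discrete MeasurableSet.of_discrete
  linarith

/-- **THE SIZE LAW ON THE SEPARATOR CLASS** (PROOFS §P56 (C1); BENCH l.191 M2-R53 (S1) with the floor / l.197 M2-R57).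
For every weighted graph in which `{x, a}` separates `b ∈ L` from `u ∉ L` (no positive weight between `L` and the vertices
off `L ∪ {x,a}`):  `(Cov − M) · (|L| + |R| + μ(x↔a)) ≤ |L| · |R| · Cov`, i.e. for `Cov > 0`
`1 + c = (Cov − M)/Cov ≤ |L||R| / (|L| + |R| + E T) ≤ ⌊(|V|−2)²/4⌋/(|V|−2)`: the vdBHK first-order constant obeys
`c ≤ C(|V|) = ⌊(n−2)²/4⌋/(n−2) − 1` on the whole separator class, all weights, every `n` (sharp: the hub–path towers).
[cite: VandenbergHaggstromKahn2005, Thm. 1.3 (p. 6)] -/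
theorem sep_sizeLaw (hx : x ∉ L) (ha : a ∉ L) (hxa : x ≠ a) (hb : b ∈ L) (hu : u ∉ L)
    (hcut : ∀ e, e ∉ sideB L ({x, a} : Set V) → e ∉ sideT L ({x, a} : Set V) → w e = 0) :
    (((prodBernoulli w).real (openConn x b ∩ openConn x u) -
        (prodBernoulli w).real (openConn x b) * (prodBernoulli w).real (openConn x u)) -
      ((prodBernoulli w).real (openConn x a ∩ openConn x b ∩ openConn x u) +
        (prodBernoulli w).real (openConn x a) * (prodBernoulli w).real (openConn x b ∩ openConn x u) -
        (prodBernoulli w).real (openConn x b) * (prodBernoulli w).real (openConn x a ∩ openConn x u) -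
        (prodBernoulli w).real (openConn x u) * (prodBernoulli w).real (openConn x a ∩ openConn x b))) *
      ((L.toFinset.card : ℝ) + ((Finset.univ.filter fun v : V => v ∉ L ∧ v ≠ x ∧ v ≠ a).card : ℝ) +
        (prodBernoulli w).real (openConn x a)) ≤
    (L.toFinset.card : ℝ) * ((Finset.univ.filter fun v : V => v ∉ L ∧ v ≠ x ∧ v ≠ a).card : ℝ) *
      ((prodBernoulli w).real (openConn x b ∩ openConn x u) -
        (prodBernoulli w).real (openConn x b) * (prodBernoulli w).real (openConn x u)) := by
  rw [sep_cov_sub_bracket_eq w hx ha hxa hb hu hcut, sep_cov_eq w hx ha hxa hb hu hcut]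
  set φL := (prodBernoulli w).real ((({ω : BondConfig V | rB L {x, a} ω x a} : Set (BondConfig V))) ∩ ((({ω : BondConfig V | rB L {x, a} ω x b} : Set (BondConfig V))) ∪ (({ω :
        BondConfig V | rB L {x, a} ω a b} : Set (BondConfig V))))) - (prodBernoulli w).real (({ω : BondConfig V | rB L {x, a} ω x a} : Set (BondConfig V))) * (prodBernoulli
        w).real ((({ω : BondConfig V | rB L {x, a} ω x b} : Set (BondConfig V))) ∪ (({ω : BondConfig V | rB L {x, a} ω a b} : Set (BondConfig V))))
  set φR := (prodBernoulli w).real ((({ω : BondConfig V | (openGraph (ω ∩ sideT L {x, a})).Reachable x a} : Set (BondConfig V))) ∩ ((({ω : BondConfig V | (openGraph (ω ∩ sideT L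
        {x, a})).Reachable x u} : Set (BondConfig V))) ∪ (({ω : BondConfig V | (openGraph (ω ∩ sideT L {x, a})).Reachable a u} : Set (BondConfig V))))) - (prodBernoulli w).real
        (({ω : BondConfig V | (openGraph (ω ∩ sideT L {x, a})).Reachable x a} : Set (BondConfig V))) * (prodBernoulli w).real ((({ω : BondConfig V | (openGraph (ω ∩ sideT L {x,
        a})).Reachable x u} : Set (BondConfig V))) ∪ (({ω : BondConfig V | (openGraph (ω ∩ sideT L {x, a})).Reachable a u} : Set (BondConfig V))))
  set jL := (prodBernoulli w).real ((({ω : BondConfig V | rB L {x, a} ω a b} : Set (BondConfig V)) ∩ ({ω : BondConfig V | rB L {x, a} ω x b} : Set (BondConfig V))ᶜ))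
  set jR := (prodBernoulli w).real ((({ω : BondConfig V | (openGraph (ω ∩ sideT L {x, a})).Reachable a u} : Set (BondConfig V)) ∩ ({ω : BondConfig V | (openGraph (ω ∩ sideT L {x,
        a})).Reachable x u} : Set (BondConfig V))ᶜ))
  set t := (prodBernoulli w).real (openConn x a)
  set nL : ℝ := (L.toFinset.card : ℝ)
  set nR : ℝ := ((Finset.univ.filter fun v : V => v ∉ L ∧ v ≠ x ∧ v ≠ a).card : ℝ)
  have hL : φL ≤ nL * jL := sep_phiL_le w L x a b
  have hR : φR ≤ nR * jR := sep_phiR_le w L x a u ha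
  have hL0 : 0 ≤ φL := sep_phiL_nonneg w L x a b
  have hR0 : 0 ≤ φR := sep_phiR_nonneg w L x a u
  have hjL : 0 ≤ jL := measureReal_nonneg
  have hjR : 0 ≤ jR := measureReal_nonneg
  have ht : 0 ≤ t := measureReal_nonneg
  have hnL : 0 ≤ nL := Nat.cast_nonneg _
  have hnR : 0 ≤ nR := Nat.cast_nonneg _
  have h1 : nL * (φL * φR) ≤ nL * (φL * (nR * jR)) :=
    mul_le_mul_of_nonneg_left (mul_le_mul_of_nonneg_left hR hL0) hnL
  have h2 : nR * (φL * φR) ≤ nR * ((nL * jL) * φR) :=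
    mul_le_mul_of_nonneg_left (mul_le_mul_of_nonneg_right hL hR0) hnR
  have h3 : t * (φL * φR) ≤ t * ((nL * jL) * (nR * jR)) :=
    mul_le_mul_of_nonneg_left (mul_le_mul hL hR hR0 (mul_nonneg hnL hjL)) ht
  nlinarith [h1, h2, h3]

/-- **The size law with the floor constant.**  In the setting of `CSH.sep_sizeLaw`, with `k = |L| + |R|` (`= |V| − 2`):
`(Cov − M) · k ≤ ⌊k²/4⌋ · Cov`, i.e. `1 + c ≤ ⌊(n−2)²/4⌋/(n−2)` — the SIZE LAW (S1) of BENCH l.191 with its sharp constant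
`C(n) = ⌊(n−2)²/4⌋/(n−2) − 1` on the whole separator class. [cite: VandenbergHaggstromKahn2005, Thm. 1.3 (p. 6)] -/
theorem sep_sizeLaw_floor (hx : x ∉ L) (ha : a ∉ L) (hxa : x ≠ a) (hb : b ∈ L) (hu : u ∉ L)
    (hcut : ∀ e, e ∉ sideB L ({x, a} : Set V) → e ∉ sideT L ({x, a} : Set V) → w e = 0) :
    (((prodBernoulli w).real (openConn x b ∩ openConn x u) -
        (prodBernoulli w).real (openConn x b) * (prodBernoulli w).real (openConn x u)) -
      ((prodBernoulli w).real (openConn x a ∩ openConn x b ∩ openConn x u) +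
        (prodBernoulli w).real (openConn x a) * (prodBernoulli w).real (openConn x b ∩ openConn x u) -
        (prodBernoulli w).real (openConn x b) * (prodBernoulli w).real (openConn x a ∩ openConn x u) -
        (prodBernoulli w).real (openConn x u) * (prodBernoulli w).real (openConn x a ∩ openConn x b))) *
      ((L.toFinset.card + (Finset.univ.filter fun v : V => v ∉ L ∧ v ≠ x ∧ v ≠ a).card : ℕ) : ℝ) ≤
    (((L.toFinset.card + (Finset.univ.filter fun v : V => v ∉ L ∧ v ≠ x ∧ v ≠ a).card) ^ 2 / 4 : ℕ) : ℝ) *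
      ((prodBernoulli w).real (openConn x b ∩ openConn x u) -
        (prodBernoulli w).real (openConn x b) * (prodBernoulli w).real (openConn x u)) := by
  have h := sep_sizeLaw w L x a b u hx ha hxa hb hu hcut
  have hD := sep_cov_sub_bracket_eq w hx ha hxa hb hu hcut
  set D := ((prodBernoulli w).real (openConn x b ∩ openConn x u) -
        (prodBernoulli w).real (openConn x b) * (prodBernoulli w).real (openConn x u)) -
      ((prodBernoulli w).real (openConn x a ∩ openConn x b ∩ openConn x u) +
        (prodBernoulli w).real (openConn x a) * (prodBernoulli w).real (openConn x b ∩ openConn x u) -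
        (prodBernoulli w).real (openConn x b) * (prodBernoulli w).real (openConn x a ∩ openConn x u) -
        (prodBernoulli w).real (openConn x u) * (prodBernoulli w).real (openConn x a ∩ openConn x b))
  set Cv := (prodBernoulli w).real (openConn x b ∩ openConn x u) -
        (prodBernoulli w).real (openConn x b) * (prodBernoulli w).real (openConn x u)
  set t := (prodBernoulli w).real (openConn x a)
  set kL : ℕ := L.toFinset.card
  set kR : ℕ := (Finset.univ.filter fun v : V => v ∉ L ∧ v ≠ x ∧ v ≠ a).card
  have hD0 : 0 ≤ D := by
    rw [hD]; exact mul_nonneg (sep_phiL_nonneg w L x a b) (sep_phiR_nonneg w L x a u)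
  have hCv : 0 ≤ Cv := by
    have := prodBernoulli_harris w (isUpperSet_openConn x b) (isUpperSet_openConn x u)
      MeasurableSet.of_discrete MeasurableSet.of_discrete
    show 0 ≤ (prodBernoulli w).real (openConn x b ∩ openConn x u) -
        (prodBernoulli w).real (openConn x b) * (prodBernoulli w).real (openConn x u)
    linarith
  have ht : 0 ≤ t := measureReal_nonneg
  have hnat : kL * kR ≤ (kL + kR) ^ 2 / 4 := by
    apply (Nat.le_div_iff_mul_le (by norm_num)).2
    nlinarith [sq_nonneg ((kL : ℤ) - kR), sq_nonneg ((kL : ℕ) + kR)]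
  have hcast : ((kL : ℝ) * kR) ≤ (((kL + kR) ^ 2 / 4 : ℕ) : ℝ) := by exact_mod_cast hnat
  have h1 : D * ((kL : ℝ) + kR) ≤ D * ((kL : ℝ) + kR + t) := by nlinarith
  have h2 : D * ((kL : ℝ) + kR + t) ≤ (kL : ℝ) * kR * Cv := h
  have h3 : (kL : ℝ) * kR * Cv ≤ (((kL + kR) ^ 2 / 4 : ℕ) : ℝ) * Cv := mul_le_mul_of_nonneg_right hcast hCv
  calc D * (((kL + kR : ℕ)) : ℝ) = D * ((kL : ℝ) + kR) := by push_cast; ring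
    _ ≤ (((kL + kR) ^ 2 / 4 : ℕ) : ℝ) * Cv := h1.trans (h2.trans h3)

end SizeLaw

end Summit.CriticalPhenomena.PercolationContinuityZ3.Theorems.CSH
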